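import Summits.ResolutionOfSingularities.ResolutionOfSingularities.Theorems.FrobeniusLadderFInjectiveMacaulayficationIntegralCore
import Summits.ResolutionOfSingularities.ResolutionOfSingularities.Theorems.FrobeniusLadderFInjectiveMacaulayficationFiLocusOpenOfAffine
import Summits.ResolutionOfSingularities.ResolutionOfSingularities.Theorems.FrobeniusLadderFInjectiveMacaulayficationClosedPointsOfClosedFinite
import Summits.ResolutionOfSingularities.ResolutionOfSingularities.Theorems.FrobeniusLadderFInjectiveMacaulayficationBadPointsClosed
import Summits.ResolutionOfSingularities.ResolutionOfSingularities.Theorems.FrobeniusLadderFInjectiveMacaulayficationSurgeryGlue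
import HarnessLib

/-!
# `FInjectiveMacaulayfication` modulo two named facts and the two research holes
# (crux stmt-ResolutionOfSingularities-15315, line `Sketch`, composition of record)

Support file for crux stmt-ResolutionOfSingularities-15315 (`FrobeniusLadder.FInjectiveMacaulayfication`), registered skeleton
10f06f91, chain w45a (lead seat res-L1-w45a-lead-1; CRUX-PLAN w45a v1 §3, director ruling 2026-08-26T18:08:56Z (A): theorems in
print enter L-chain proofs as NAMED-FACT HYPOTHESES). THE THEOREM `fInjectiveMacaulayfication_of_facts`: the crux follows from

* `hK : Literature.AlgebraicGeometry.Resolution.KawasakiMacaulayfication.{0}` — Macaulayfication of integral schemes of finite type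
  over a field (Kawasaki 2000 Thm 1.1; the tree's named fact, literally registered stub #1 `stub_kawasakiIntegral`);
* `hDM` — openness of the F-injective locus, RING-LEVEL form for Cohen–Macaulay algebras of finite type over a field of characteristic
  `p` (Datta–Murayama, MRL 31 (2024) Thm B, read through Quy–Shimomoto 2017: on Cohen–Macaulay local rings F-injective ⟺ every
  parameter ideal Frobenius closed); transported to schemes by `FiLocusOpenOfAffine.fiLocusOpen_of_ringLevel` (p461884) = stub #2;
* `hISO` — registered stub #3 `stub_genericFInjectivization` verbatim (ISO: F-injectivize all NON-CLOSED points of an integral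
  Cohen–Macaulay `X₁/k`, keeping Cohen–Macaulayness) — research hole;
* `hPT` — registered stub #4 `stub_pointCentreExists` verbatim (PT: a point-supported good centre at an isolated bad point) —
  research hole;

by the composition of the skeleton: `IntegralCore.fInjectiveMacaulayfication_of_kawasaki_of_stubFInjectivizeIntegral` (p140938:
reduction to integral `X` and Kawasaki below) applied to the open core `stub_fInjectivizeIntegral`, itself derived (§3a of the
skeleton, here `fInjectivizeIntegral_of_facts`) from ISO, the finiteness of the residual bad set (`hDM` + p461884 + 
`ClosedPointsOfClosedFinite` p157294), `BadPointsClosed` (p157350), PT and `SurgeryGlue` (p157783). Bookkeeping consequence: when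
#3 and #4 close, the crux is CLOSED-MODULO-FACTS [Kawasaki2000 Thm 1.1; DattaMurayama2024 Thm B] — never counted as the item closing.
-/

set_option linter.dupNamespace false

open AlgebraicGeometry CategoryTheory Literature.AlgebraicGeometry.Resolution

namespace Summit.ResolutionOfSingularities.ResolutionOfSingularities.Theorems.FInjectiveMacaulayfication.OfFacts

/-- **ISOLATED F-INJECTIVIZATION from the local core PT** (= §3a of the skeleton, kernel-checked there since cycle 8): an
integral Cohen–Macaulay `X₁/k` with finitely many bad points has a proper birational model with the full clause at every
stalk — each bad point is closed (`BadPointsClosed.stub_badPointsClosed`), PT supplies a point-supported good centre there,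
`SurgeryGlue.stub_surgeryGlue` glues. [folklore] -/
theorem isolatedFInjectivization_of_pointCentreExists
    (hPT : ∀ (p : ℕ), p.Prime → ∀ (k : Type) [Field k] [CharP k p] (X₁ : Scheme.{0}) (f₁ : X₁ ⟶ Spec (.of k)), IsSeparated f₁ → LocallyOfFiniteType f₁ → QuasiCompact f₁ → IsIntegral X₁ → (∀ x : X₁, ∀ d : ℕ, ringKrullDim (X₁.presheaf.stalk x) = d → ∀ s : Fin d → X₁.presheaf.stalk x, (Ideal.span (Set.range s)).radical.IsMaximal → RingTheory.Sequence.IsWeaklyRegular (X₁.presheaf.stalk x) (List.ofFn s)) → Set.Finite {x : X₁ | ¬ ∀ d : ℕ, ringKrullDim (X₁.presheaf.stalk x) = d → ∀ s : Fin d → X₁.presheaf.stalk x, (Ideal.span (Set.range s)).radical.IsMaximal → ∀ y : X₁.presheaf.stalk x, (∃ e : ℕ, y ^ p ^ e ∈ Ideal.span ((fun z : X₁.presheaf.stalk x => z ^ p ^ e) '' (Ideal.span (Set.range s) : Set (X₁.presheaf.stalk x)))) → y ∈ Ideal.span (Set.range s)} → ∀ b : X₁, IsClosed ({b} : Set X₁)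 → (¬ ∀ d : ℕ, ringKrullDim (X₁.presheaf.stalk b) = d → ∀ s : Fin d → X₁.presheaf.stalk b, (Ideal.span (Set.range s)).radical.IsMaximal → ∀ y : X₁.presheaf.stalk b, (∃ e : ℕ, y ^ p ^ e ∈ Ideal.span ((fun z : X₁.presheaf.stalk b => z ^ p ^ e) '' (Ideal.span (Set.range s) : Set (X₁.presheaf.stalk b)))) → y ∈ Ideal.span (Set.range s)) → ∃ J : X₁.IdealSheafData, J ≠ ⊥ ∧ (J.support : Set X₁) = {b} ∧ ∀ (X' : Scheme.{0}) (π : X' ⟶ X₁), Literature.AlgebraicGeometry.Resolution.IsBlowup π J → ∀ x' : X', π.base x' = b → IsDomain (X'.presheaf.stalk x') ∧ ∀ d : ℕ, ringKrullDim (X'.presheaf.stalk x') = d → ∀ s : Fin d → X'.presheaf.stalk x', (Ideal.span (Set.range s)).radical.IsMaximal → RingTheory.Sequence.IsWeaklyRegular (X'.presheaf.stalk x') (List.ofFn s) ∧ ∀ y : X'.presheaf.stalk x', (∃ e : ℕ, y ^ p ^ e ∈ Ideal.span ((fun z : X'.presheaf.stalk x' => z ^ p ^ e) '' (Ideal.span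 (Set.range s) : Set (X'.presheaf.stalk x')))) → y ∈ Ideal.span (Set.range s)) :
    ∀ p : ℕ, p.Prime → ∀ (k : Type) [Field k] [CharP k p] (X₁ : Scheme.{0}) (f₁ : X₁ ⟶ Spec (.of k)),
    IsSeparated f₁ → LocallyOfFiniteType f₁ → QuasiCompact f₁ → IsIntegral X₁ →
    (∀ x : X₁, ∀ d : ℕ, ringKrullDim (X₁.presheaf.stalk x) = d → ∀ s : Fin d → X₁.presheaf.stalk x,
      (Ideal.span (Set.range s)).radical.IsMaximal → RingTheory.Sequence.IsWeaklyRegular (X₁.presheaf.stalk x) (List.ofFn s)) →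
    Set.Finite {x : X₁ | ¬ ∀ d : ℕ, ringKrullDim (X₁.presheaf.stalk x) = d → ∀ s : Fin d → X₁.presheaf.stalk x,
      (Ideal.span (Set.range s)).radical.IsMaximal → ∀ y : X₁.presheaf.stalk x, (∃ e : ℕ, y ^ p ^ e ∈
        Ideal.span ((fun z : X₁.presheaf.stalk x => z ^ p ^ e) '' (Ideal.span (Set.range s) : Set (X₁.presheaf.stalk x)))) →
          y ∈ Ideal.span (Set.range s)} →
    ∃ (X' : Scheme.{0}) (π : X' ⟶ X₁), IsProper π ∧ Literature.AlgebraicGeometry.Resolution.IsBirational π ∧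
      ∀ x : X', IsDomain (X'.presheaf.stalk x) ∧ ∀ d : ℕ, ringKrullDim (X'.presheaf.stalk x) = d →
        ∀ s : Fin d → X'.presheaf.stalk x, (Ideal.span (Set.range s)).radical.IsMaximal →
          RingTheory.Sequence.IsWeaklyRegular (X'.presheaf.stalk x) (List.ofFn s) ∧
          ∀ y : X'.presheaf.stalk x, (∃ e : ℕ, y ^ p ^ e ∈
              Ideal.span ((fun z : X'.presheaf.stalk x => z ^ p ^ e) '' (Ideal.span (Set.range s) : Set (X'.presheaf.stalk x)))) →
            y ∈ Ideal.span (Set.range s) := by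
  intro p hp k _ _ X₁ f₁ hsep hft hqc hint hCM hfin
  classical
  -- abbreviate the bad-point predicate
  set Bad : X₁ → Prop := fun x => ¬ ∀ d : ℕ, ringKrullDim (X₁.presheaf.stalk x) = d → ∀ s : Fin d → X₁.presheaf.stalk x,
    (Ideal.span (Set.range s)).radical.IsMaximal → ∀ y : X₁.presheaf.stalk x, (∃ e : ℕ, y ^ p ^ e ∈
      Ideal.span ((fun z : X₁.presheaf.stalk x => z ^ p ^ e) '' (Ideal.span (Set.range s) : Set (X₁.presheaf.stalk x)))) →
        y ∈ Ideal.span (Set.range s) with hBad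
  have hclosed : ∀ b : X₁, Bad b → IsClosed ({b} : Set X₁) := fun b hb =>
    BadPointsClosed.stub_badPointsClosed p hp k X₁ f₁ hft hqc hCM hfin b hb
  have hJ : ∀ b : X₁, ∃ J : X₁.IdealSheafData, Bad b →
        (J ≠ ⊥ ∧ (J.support : Set X₁) = {b} ∧
          ∀ (X' : Scheme.{0}) (π : X' ⟶ X₁), Literature.AlgebraicGeometry.Resolution.IsBlowup π J →
            ∀ x' : X', π.base x' = b → IsDomain (X'.presheaf.stalk x') ∧ ∀ d : ℕ, ringKrullDim (X'.presheaf.stalk x') = d →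
              ∀ s : Fin d → X'.presheaf.stalk x', (Ideal.span (Set.range s)).radical.IsMaximal →
                RingTheory.Sequence.IsWeaklyRegular (X'.presheaf.stalk x') (List.ofFn s) ∧
                ∀ y : X'.presheaf.stalk x', (∃ e : ℕ, y ^ p ^ e ∈ Ideal.span ((fun z : X'.presheaf.stalk x' => z ^ p ^ e) ''
                  (Ideal.span (Set.range s) : Set (X'.presheaf.stalk x')))) → y ∈ Ideal.span (Set.range s)) := by
    intro b
    by_cases hb : Bad b
    · obtain ⟨J, hJ⟩ := hPT p hp k X₁ f₁ hsep hft hqc hint hCM hfin b (hclosed b hb) hb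
      exact ⟨J, fun _ => hJ⟩
    · exact ⟨⊤, fun h => absurd h hb⟩
  choose J hJ using hJ
  exact SurgeryGlue.stub_surgeryGlue p hp k X₁ f₁ hsep hft hqc hint hCM {x | Bad x} hfin (fun b hb => hclosed b hb)
    (fun x hx => hx) J (fun b hb => hJ b hb)

/-- **THE OPEN CORE modulo ISO, PT and the Datta–Murayama fact** (= §3a of the skeleton): for an integral Cohen–Macaulay
`X₁/k` (finite type, `char k = p`): ISO gives an integral Cohen–Macaulay model `X₂` bad only at closed points; by the
ring-level openness fact `hDM` (transported by `FiLocusOpenOfAffine.fiLocusOpen_of_ringLevel`, p461884) the bad set is closed,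
hence finite (`ClosedPointsOfClosedFinite.stub_closedPointsOfClosedFinite`, p157294); PT + surgery finish. [folklore] -/
theorem fInjectivizeIntegral_of_facts
    (hDM : ∀ (p : ℕ), p.Prime → ∀ (k : Type) [Field k] [CharP k p],
      ∀ (R : Type) [CommRing R] [Algebra k R], Algebra.FiniteType k R →
      (∀ (P : Ideal R) [P.IsPrime], ∀ d : ℕ, ringKrullDim (Localization.AtPrime P) = d →
        ∀ s : Fin d → Localization.AtPrime P, (Ideal.span (Set.range s)).radical.IsMaximal →
          RingTheory.Sequence.IsWeaklyRegular (Localization.AtPrime P) (List.ofFn s)) →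
      IsOpen {P : PrimeSpectrum R | ∀ d : ℕ, ringKrullDim (Localization.AtPrime P.asIdeal) = d →
        ∀ s : Fin d → Localization.AtPrime P.asIdeal, (Ideal.span (Set.range s)).radical.IsMaximal →
          ∀ y : Localization.AtPrime P.asIdeal, (∃ e : ℕ, y ^ p ^ e ∈ Ideal.span
            ((fun z : Localization.AtPrime P.asIdeal => z ^ p ^ e) ''
              (Ideal.span (Set.range s) : Set (Localization.AtPrime P.asIdeal)))) →
            y ∈ Ideal.span (Set.range s)})
    (hISO : ∀ (p : ℕ), p.Prime → ∀ (k : Type) [Field k] [CharP k p] (X₁ : Scheme.{0}) (f₁ : X₁ ⟶ Spec (.of k)), IsSeparated f₁ → LocallyOfFiniteType f₁ → QuasiCompact f₁ → IsIntegral X₁ → (∀ x : X₁, ∀ d : ℕ, ringKrullDim (X₁.presheaf.stalk x) = d → ∀ s : Fin d → X₁.presheaf.stalk x, (Ideal.span (Set.range s)).radical.IsMaximal → RingTheory.Sequence.IsWeaklyRegular (X₁.presheaf.stalk x) (List.ofFn s)) → ∃ (X₂ : Scheme.{0}) (π : X₂ ⟶ X₁), IsProper π ∧ Literature.AlgebraicGeometry.Resolution.IsBirational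 π ∧ IsIntegral X₂ ∧ (∀ x : X₂, ∀ d : ℕ, ringKrullDim (X₂.presheaf.stalk x) = d → ∀ s : Fin d → X₂.presheaf.stalk x, (Ideal.span (Set.range s)).radical.IsMaximal → RingTheory.Sequence.IsWeaklyRegular (X₂.presheaf.stalk x) (List.ofFn s)) ∧ ∀ x : X₂, ¬ IsClosed ({x} : Set X₂) → ∀ d : ℕ, ringKrullDim (X₂.presheaf.stalk x) = d → ∀ s : Fin d → X₂.presheaf.stalk x, (Ideal.span (Set.range s)).radical.IsMaximal → ∀ y : X₂.presheaf.stalk x, (∃ e : ℕ, y ^ p ^ e ∈ Ideal.span ((fun z : X₂.presheaf.stalk x => z ^ p ^ e) '' (Ideal.span (Set.range s) : Set (X₂.presheaf.stalk x)))) → y ∈ Ideal.span (Set.range s))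
    (hPT : ∀ (p : ℕ), p.Prime → ∀ (k : Type) [Field k] [CharP k p] (X₁ : Scheme.{0}) (f₁ : X₁ ⟶ Spec (.of k)), IsSeparated f₁ → LocallyOfFiniteType f₁ → QuasiCompact f₁ → IsIntegral X₁ → (∀ x : X₁, ∀ d : ℕ, ringKrullDim (X₁.presheaf.stalk x) = d → ∀ s : Fin d → X₁.presheaf.stalk x, (Ideal.span (Set.range s)).radical.IsMaximal → RingTheory.Sequence.IsWeaklyRegular (X₁.presheaf.stalk x) (List.ofFn s)) → Set.Finite {x : X₁ | ¬ ∀ d : ℕ, ringKrullDim (X₁.presheaf.stalk x) = d → ∀ s : Fin d → X₁.presheaf.stalk x, (Ideal.span (Set.range s)).radical.IsMaximal → ∀ y : X₁.presheaf.stalk x, (∃ e : ℕ, y ^ p ^ e ∈ Ideal.span ((fun z : X₁.presheaf.stalk x => z ^ p ^ e) '' (Ideal.span (Set.range s) : Set (X₁.presheaf.stalk x)))) → y ∈ Ideal.span (Set.range s)} → ∀ b : X₁, IsClosed ({b} : Set X₁) → (¬ ∀ d : ℕ, ringKrullDim (X₁.presheaf.stalk b) = d → ∀ s : Fin d → X₁.presheaf.stalk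 b, (Ideal.span (Set.range s)).radical.IsMaximal → ∀ y : X₁.presheaf.stalk b, (∃ e : ℕ, y ^ p ^ e ∈ Ideal.span ((fun z : X₁.presheaf.stalk b => z ^ p ^ e) '' (Ideal.span (Set.range s) : Set (X₁.presheaf.stalk b)))) → y ∈ Ideal.span (Set.range s)) → ∃ J : X₁.IdealSheafData, J ≠ ⊥ ∧ (J.support : Set X₁) = {b} ∧ ∀ (X' : Scheme.{0}) (π : X' ⟶ X₁), Literature.AlgebraicGeometry.Resolution.IsBlowup π J → ∀ x' : X', π.base x' = b → IsDomain (X'.presheaf.stalk x') ∧ ∀ d : ℕ, ringKrullDim (X'.presheaf.stalk x') = d → ∀ s : Fin d → X'.presheaf.stalk x', (Ideal.span (Set.range s)).radical.IsMaximal → RingTheory.Sequence.IsWeaklyRegular (X'.presheaf.stalk x') (List.ofFn s) ∧ ∀ y : X'.presheaf.stalk x', (∃ e : ℕ, y ^ p ^ e ∈ Ideal.span ((fun z : X'.presheaf.stalk x' => z ^ p ^ e) '' (Ideal.span (Set.range s) : Set (X'.presheaf.stalk x')))) → y ∈ Ideal.span (Set.range s)) :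
    ∀ (p : ℕ), p.Prime → ∀ (k : Type) [Field k] [CharP k p]
    (X₁ : Scheme.{0}) (f₁ : X₁ ⟶ Spec (.of k)), IsSeparated f₁ → LocallyOfFiniteType f₁ → QuasiCompact f₁ →
      IsIntegral X₁ →
      (∀ x : X₁, ∀ d : ℕ, ringKrullDim (X₁.presheaf.stalk x) = d →
        ∀ s : Fin d → X₁.presheaf.stalk x, (Ideal.span (Set.range s)).radical.IsMaximal →
          RingTheory.Sequence.IsWeaklyRegular (X₁.presheaf.stalk x) (List.ofFn s)) →
      ∃ (X' : Scheme.{0}) (π : X' ⟶ X₁), IsProper π ∧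
        Literature.AlgebraicGeometry.Resolution.IsBirational π ∧
        ∀ x : X', IsDomain (X'.presheaf.stalk x) ∧ ∀ d : ℕ, ringKrullDim (X'.presheaf.stalk x) = d →
          ∀ s : Fin d → X'.presheaf.stalk x, (Ideal.span (Set.range s)).radical.IsMaximal →
            RingTheory.Sequence.IsWeaklyRegular (X'.presheaf.stalk x) (List.ofFn s) ∧
            ∀ y : X'.presheaf.stalk x, (∃ e : ℕ, y ^ p ^ e ∈
                Ideal.span ((fun z : X'.presheaf.stalk x => z ^ p ^ e) ''
                  (Ideal.span (Set.range s) : Set (X'.presheaf.stalk x)))) →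
              y ∈ Ideal.span (Set.range s) := by
  intro p hp k _ _ X₁ f₁ hsep hft hqc hint hCM
  -- (1) the codimension climb: clause at every non-closed point of an integral Cohen–Macaulay model `X₂`
  obtain ⟨X₂, π₂, hπ₂, hbir₂, hint₂, hCM₂, hgen⟩ := hISO p hp k X₁ f₁ hsep hft hqc hint hCM
  haveI := hπ₂
  haveI := hsep
  haveI := hft
  haveI := hqc
  have hsep₂ : IsSeparated (π₂ ≫ f₁) := inferInstance
  have hft₂ : LocallyOfFiniteType (π₂ ≫ f₁) := inferInstance
  have hqc₂ : QuasiCompact (π₂ ≫ f₁) := inferInstance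
  -- (2) the bad set of `X₂` is closed (openness of the F-injective locus) and consists of closed points, hence finite
  have hfin : Set.Finite {x : X₂ | ¬ ∀ d : ℕ, ringKrullDim (X₂.presheaf.stalk x) = d → ∀ s : Fin d → X₂.presheaf.stalk x,
      (Ideal.span (Set.range s)).radical.IsMaximal → ∀ y : X₂.presheaf.stalk x, (∃ e : ℕ, y ^ p ^ e ∈
        Ideal.span ((fun z : X₂.presheaf.stalk x => z ^ p ^ e) '' (Ideal.span (Set.range s) : Set (X₂.presheaf.stalk x)))) →
          y ∈ Ideal.span (Set.range s)} := by
    have hopen := FiLocusOpenOfAffine.fiLocusOpen_of_ringLevel p k (hDM p hp k) X₂ (π₂ ≫ f₁) hft₂ hCM₂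
    refine ClosedPointsOfClosedFinite.stub_closedPointsOfClosedFinite k X₂ (π₂ ≫ f₁) hft₂ hqc₂ _ ?_ ?_
    · rw [← Set.compl_setOf]
      exact hopen.isClosed_compl
    · intro x hx
      by_contra hcl
      exact hx (hgen x hcl)
  -- (3) isolated F-injectivization of `X₂` by point-supported centres, composed with `π₂`
  obtain ⟨X', π, hπ, hbir, hgood⟩ :=
    isolatedFInjectivization_of_pointCentreExists hPT p hp k X₂ (π₂ ≫ f₁) hsep₂ hft₂ hqc₂ hint₂ hCM₂ hfin
  haveI := hπ
  exact ⟨X', π ≫ π₂, inferInstance,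
    Literature.AlgebraicGeometry.Resolution.ComponentGluing.IsBirational.comp hbir hbir₂, hgood⟩

/-- **`FInjectiveMacaulayfication` MODULO FACTS** (CRUX-PLAN w45a v1 §3, the chain's bankable composition): the crux
`FrobeniusLadder.FInjectiveMacaulayfication` follows from the named facts Kawasaki 2000 Thm 1.1 (`KawasakiMacaulayfication`, the
tree's `def`, literally stub #1) and Datta–Murayama 2024 Thm B in ring-level Cohen–Macaulay form (`hDM`, stub #2 via p461884),
together with the two research holes ISO (`hISO` = stub #3) and PT (`hPT` = stub #4) — by the reduction to integral `X` and the
Macaulayfication below (`IntegralCore.fInjectiveMacaulayfication_of_kawasaki_of_stubFInjectivizeIntegral`, p140938) applied to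
`fInjectivizeIntegral_of_facts`. [folklore] -/
theorem fInjectiveMacaulayfication_of_facts
    (hK : Literature.AlgebraicGeometry.Resolution.KawasakiMacaulayfication.{0})
    (hDM : ∀ (p : ℕ), p.Prime → ∀ (k : Type) [Field k] [CharP k p],
      ∀ (R : Type) [CommRing R] [Algebra k R], Algebra.FiniteType k R →
      (∀ (P : Ideal R) [P.IsPrime], ∀ d : ℕ, ringKrullDim (Localization.AtPrime P) = d →
        ∀ s : Fin d → Localization.AtPrime P, (Ideal.span (Set.range s)).radical.IsMaximal →
          RingTheory.Sequence.IsWeaklyRegular (Localization.AtPrime P) (List.ofFn s)) →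
      IsOpen {P : PrimeSpectrum R | ∀ d : ℕ, ringKrullDim (Localization.AtPrime P.asIdeal) = d →
        ∀ s : Fin d → Localization.AtPrime P.asIdeal, (Ideal.span (Set.range s)).radical.IsMaximal →
          ∀ y : Localization.AtPrime P.asIdeal, (∃ e : ℕ, y ^ p ^ e ∈ Ideal.span
            ((fun z : Localization.AtPrime P.asIdeal => z ^ p ^ e) ''
              (Ideal.span (Set.range s) : Set (Localization.AtPrime P.asIdeal)))) →
            y ∈ Ideal.span (Set.range s)})
    (hISO : ∀ (p : ℕ), p.Prime → ∀ (k : Type) [Field k] [CharP k p] (X₁ : Scheme.{0}) (f₁ : X₁ ⟶ Spec (.of k)), IsSeparated f₁ → LocallyOfFiniteType f₁ → QuasiCompact f₁ → IsIntegral X₁ → (∀ x : X₁, ∀ d : ℕ, ringKrullDim (X₁.presheaf.stalk x) = d → ∀ s : Fin d → X₁.presheaf.stalk x, (Ideal.span (Set.range s)).radical.IsMaximal → RingTheory.Sequence.IsWeaklyRegular (X₁.presheaf.stalk x) (List.ofFn s)) → ∃ (X₂ : Scheme.{0}) (π : X₂ ⟶ X₁), IsProper π ∧ Literature.AlgebraicGeometry.Resolution.IsBirational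 π ∧ IsIntegral X₂ ∧ (∀ x : X₂, ∀ d : ℕ, ringKrullDim (X₂.presheaf.stalk x) = d → ∀ s : Fin d → X₂.presheaf.stalk x, (Ideal.span (Set.range s)).radical.IsMaximal → RingTheory.Sequence.IsWeaklyRegular (X₂.presheaf.stalk x) (List.ofFn s)) ∧ ∀ x : X₂, ¬ IsClosed ({x} : Set X₂) → ∀ d : ℕ, ringKrullDim (X₂.presheaf.stalk x) = d → ∀ s : Fin d → X₂.presheaf.stalk x, (Ideal.span (Set.range s)).radical.IsMaximal → ∀ y : X₂.presheaf.stalk x, (∃ e : ℕ, y ^ p ^ e ∈ Ideal.span ((fun z : X₂.presheaf.stalk x => z ^ p ^ e) '' (Ideal.span (Set.range s) : Set (X₂.presheaf.stalk x)))) → y ∈ Ideal.span (Set.range s))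
    (hPT : ∀ (p : ℕ), p.Prime → ∀ (k : Type) [Field k] [CharP k p] (X₁ : Scheme.{0}) (f₁ : X₁ ⟶ Spec (.of k)), IsSeparated f₁ → LocallyOfFiniteType f₁ → QuasiCompact f₁ → IsIntegral X₁ → (∀ x : X₁, ∀ d : ℕ, ringKrullDim (X₁.presheaf.stalk x) = d → ∀ s : Fin d → X₁.presheaf.stalk x, (Ideal.span (Set.range s)).radical.IsMaximal → RingTheory.Sequence.IsWeaklyRegular (X₁.presheaf.stalk x) (List.ofFn s)) → Set.Finite {x : X₁ | ¬ ∀ d : ℕ, ringKrullDim (X₁.presheaf.stalk x) = d → ∀ s : Fin d → X₁.presheaf.stalk x, (Ideal.span (Set.range s)).radical.IsMaximal → ∀ y : X₁.presheaf.stalk x, (∃ e : ℕ, y ^ p ^ e ∈ Ideal.span ((fun z : X₁.presheaf.stalk x => z ^ p ^ e) '' (Ideal.span (Set.range s) : Set (X₁.presheaf.stalk x)))) → y ∈ Ideal.span (Set.range s)} → ∀ b : X₁, IsClosed ({b} : Set X₁) → (¬ ∀ d : ℕ, ringKrullDim (X₁.presheaf.stalk b) = d → ∀ s : Fin d → X₁.presheaf.stalk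 b, (Ideal.span (Set.range s)).radical.IsMaximal → ∀ y : X₁.presheaf.stalk b, (∃ e : ℕ, y ^ p ^ e ∈ Ideal.span ((fun z : X₁.presheaf.stalk b => z ^ p ^ e) '' (Ideal.span (Set.range s) : Set (X₁.presheaf.stalk b)))) → y ∈ Ideal.span (Set.range s)) → ∃ J : X₁.IdealSheafData, J ≠ ⊥ ∧ (J.support : Set X₁) = {b} ∧ ∀ (X' : Scheme.{0}) (π : X' ⟶ X₁), Literature.AlgebraicGeometry.Resolution.IsBlowup π J → ∀ x' : X', π.base x' = b → IsDomain (X'.presheaf.stalk x') ∧ ∀ d : ℕ, ringKrullDim (X'.presheaf.stalk x') = d → ∀ s : Fin d → X'.presheaf.stalk x', (Ideal.span (Set.range s)).radical.IsMaximal → RingTheory.Sequence.IsWeaklyRegular (X'.presheaf.stalk x') (List.ofFn s) ∧ ∀ y : X'.presheaf.stalk x', (∃ e : ℕ, y ^ p ^ e ∈ Ideal.span ((fun z : X'.presheaf.stalk x' => z ^ p ^ e) '' (Ideal.span (Set.range s) : Set (X'.presheaf.stalk x')))) → y ∈ Ideal.span (Set.range s)) :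
    Summit.ResolutionOfSingularities.ResolutionOfSingularities.Theses.FrobeniusLadder.FInjectiveMacaulayfication :=
  IntegralCore.fInjectiveMacaulayfication_of_kawasaki_of_stubFInjectivizeIntegral hK (fInjectivizeIntegral_of_facts hDM hISO hPT)

end Summit.ResolutionOfSingularities.ResolutionOfSingularities.Theorems.FInjectiveMacaulayfication.OfFacts
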